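import Mathlib
import HarnessLib
import Summits.AtomisticToContinuum.FouriersLaw.Statement
import Summits.AtomisticToContinuum.FouriersLaw.Theses.ContactStieltjesMeasure
import Summits.AtomisticToContinuum.FouriersLaw.Theses.BoundaryEscapeDeficit
import Summits.AtomisticToContinuum.FouriersLaw.Theses.OddSectorIrreversibility
import Summits.AtomisticToContinuum.FouriersLaw.Theorems.OddSectorIrreversibilityBoundedResponseConvergesEscapeDeficitForm
import Summits.AtomisticToContinuum.FouriersLaw.Theorems.EmbeddedDrudeMourreNessUnique
import Literature.MathematicalPhysics.KineticTheory.LangevinChainNESSHolds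

/-!
# Crux `ContactMeasureLimit` (stmt-AtomisticToContinuum-15250) — line `escape-import`
# (crux-strategist b1, 2026-08-17): the contact-measure crux is the ANALYSIS THEOREM plus two EXISTING items

Route `route-AtomisticToContinuum-ContactStieltjesMeasure` (sub-problem `FouriersLaw`), crux (M): for every family
`Φ_N` of contact distribution functions REPRESENTING the two-terminal response of `pinnedChain ω₂ lam β ·` at `T`
and every friction `γ` (the data of K2), the scaled distribution functions `N·Φ_N` converge at the continuity
points `t > 0` of a monotone `M`.

This is the ALTERNATIVE line to `Lines/birth.lean` (untouched). WHY THIS SHAPE. Three facts are now theorems of the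
tree: weak-NESS uniqueness (`Theorems.nessUnique_proof`, item 0741), existence of steady states at every length
(`pinnedChain_exists_isSteadyState`), and the RESPONSE IDENTITY (`Theorems.responseCoeff_eq_escapeDeficit`, over the
landed `responseIdentity_proof`): along any steady-state family every clause-(ii) response coefficient IS the explicit
EQUILIBRIUM escape-deficit sequence `e_N(γ) = (N−1)·γ·E_N(γ)` of route `BoundaryEscapeDeficit`. Hence a representing
family is PINNED by the chain: `∫₀^∞ Φ_N(t)·2t/(γ²+t²)² dt = E_N(γ)` for all `N ≥ 2`, `γ > 0` (uniqueness of limits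
along `𝓝[≠] 0`), and birth's physical stub "`N·∫Φ_N k_γ` converges for every `γ`" is literally "`e_N(γ)` converges in
`ℝ` for every `γ`" — which is the conjunction of two items ALREADY typed, stamped and staffed on sibling routes:

* `BoundaryEscapeDeficit.EscapeNonOscillation` (stmt-AtomisticToContinuum-12238): `N ↦ (N−1)·γ·E_N` has a limit in
  `EReal` — no oscillation (no value, no finiteness claimed);
* `OddSectorIrreversibility.BoundedResponse` (stmt-AtomisticToContinuum-10924): clause-(ii) response coefficients are
  bounded in `N` — the catalogued barrier `HasBoundedResponse` as an item (on THIS route it is implied by crux (U)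
  `ContactUpperDensity`, cf. the `closes` proof; taken here by name in its weakest filed form).

So the skeleton is `stub_stieltjesContinuity` (pure real analysis, SHARED verbatim with `birth`) + the two items BY NAME,
and the composition `ContactMeasureLimit_of` is kernel-checked: canonical family by choice, `D_N := (N−1)γ∫Φ_N k_γ`
(`0` below `N = 2`, no bonds), `BoundedResponse` caps `|D_N|`, `EscapeNonOscillation` + the response identity give an
`EReal` limit of `D_N`, the squeeze makes it real, `N∫Φ_N k_γ = D_N·N/((N−1)γ)` converges, and the continuity theorem
turns per-friction convergence of the contact transforms into convergence of `N·Φ_N` at continuity points.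

CONSEQUENCE FOR STAFFING (the point of the line): crux (M) carries NO physics of its own — its `N`-uniform content is
item 12238 (∧ 10924), already the residual node of `BoundedResponseConverges` (stmt-9141, five strategist censuses:
no-strategy-short-of-summit beyond `9141 ⇐ 12238 ∧ 11749`); what is PROPER to (M) is `stub_stieltjesContinuity`, an
L-sized Lean theorem (Stone–Weierstrass on `[0,∞]` for the algebra generated by `1, (z+s²)⁻¹` + Riesz–Markov /
Helly), claimable now. Exactness modulo the route: granted K2 and (U), (M) ⟹ 12238 at every `γ` (dominated
convergence, the `closes` computation), so on this route `K2 ∧ (U) → ((M) ↔ 12238)`; and by the continuity theorem the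
failure of 12238 cannot be confined to SOME couplings: under K2 ∧ (U), `EscapeNonOscillation` on any open friction
window implies it at every friction (recorded in `STRATEGY-CENSUS.md`, not used here).

Disproof used: none exists for this crux (`disproof_path` absent 2026-08-17). Barriers: `HasBoundedResponse` — taken
BY NAME as stub 3 (it is item 10924; not evaded, not hidden); `HarmonicChainBallisticFlux` — honoured: at
`lam = β = 0` stub 3 is false (`not_hasBoundedResponse`) and stub 2 holds with limit `⊤`, exactly as the crux requires
`lam, β > 0`; `BeckerMenegaki2022_gapClosing`, Mazur — not touched (no gap, no rate, no conserved quantity).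
-/

noncomputable section

namespace Summit.AtomisticToContinuum.FouriersLaw.Cruxes.ContactMeasureLimit.EscapeImport

open Filter MeasureTheory Set Topology
open Literature.MathematicalPhysics.KineticTheory.HeatConduction
open Summit.AtomisticToContinuum.FouriersLaw.Theses

/-! ## The three stubs (`sorry` lives only here) -/

/-- stub 1 — STIELTJES CONTINUITY THEOREM for the contact kernel (pure real analysis; verbatim the stub of
`Lines/birth.lean`, so one proof serves both lines). Monotone `F_N` vanishing on `(-∞,0]`, each bounded, whose
contact transforms `∫_(t>0) F_N(t)·2t/(γ²+t²)² dt` converge for every `γ > 0`, converge themselves at every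
continuity point `t > 0` of some monotone `M`. (A priori local bound `F_N(t) ≤ (γ²+t²)·sup_N ∫F_N k_γ` from ONE
friction; normalise `ρ_N := (γ₀²+s²)⁻¹dF_N`, bounded total mass; the span of `1` and `(γ²+s²)⁻¹`, `γ > 0`, is dense in
`C([0,∞])` by Stone–Weierstrass (partial fractions make it an algebra); Riesz–Markov on the compactification gives the
weak limit `ρ` (mass at `∞` = escaped mass), Portmanteau at `ρ`-continuity points, `M(t) = ∫_[0,t](γ₀²+s²)dρ`.) -/
theorem stub_stieltjesContinuity :
    ∀ F : ℕ → ℝ → ℝ,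
      (∀ N : ℕ, Monotone (F N) ∧ (∀ s : ℝ, s ≤ 0 → F N s = 0) ∧ (∃ m : ℝ, ∀ s : ℝ, F N s ≤ m)) →
      (∀ γ : ℝ, 0 < γ → ∃ L : ℝ,
        Filter.Tendsto (fun N : ℕ => ∫ t in Set.Ioi (0 : ℝ), F N t * (2 * t / (γ ^ 2 + t ^ 2) ^ 2))
          Filter.atTop (nhds L)) →
      ∃ M : ℝ → ℝ, Monotone M ∧ ∀ t : ℝ, 0 < t → ContinuousAt M t →
        Filter.Tendsto (fun N : ℕ => F N t) Filter.atTop (nhds (M t)) := by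
  sorry

/-- stub 2 — NO OSCILLATION of the escape deficit: item stmt-AtomisticToContinuum-12238 BY NAME
(`N ↦ (N−1)·γ·E_N` has a limit in `EReal`, for all parameters `> 0` and `T > 0`). -/
theorem stub_escapeNonOscillation : BoundaryEscapeDeficit.EscapeNonOscillation := by
  sorry

/-- stub 3 — BOUNDED RESPONSE: item stmt-AtomisticToContinuum-10924 BY NAME (clause-(ii) response
coefficients bounded in `N`; the catalogued barrier `HasBoundedResponse` as a typed item; on this route a
consequence of crux (U) `ContactUpperDensity`). -/
theorem stub_boundedResponse : OddSectorIrreversibility.BoundedResponse := by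
  sorry

/-! ## Glue, part 1: the representing hypothesis and the per-friction convergence of the scaled transforms -/

/-- The crux's REPRESENTING hypothesis on a family `Φ` at `(ω₂, lam, β, T)`, verbatim (an abbreviation for this
file; `ContactMeasureLimit` is `∀ …, IsRepresenting ω₂ lam β T Φ → ∃ M, …` by `Iff.rfl`). -/
def IsRepresenting (ω₂ lam β T : ℝ) (Φ : ℕ → ℝ → ℝ) : Prop :=
  ∀ N : ℕ, 2 ≤ N → Monotone (Φ N) ∧ (∀ s : ℝ, s ≤ 0 → Φ N s = 0) ∧ (∃ m : ℝ, ∀ s : ℝ, Φ N s ≤ m) ∧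
    ∀ γ : ℝ, 0 < γ →
      (∀ (N' : ℕ) (T_L T_R : ℝ), 0 < T_L → 0 < T_R →
        ∀ μ ν : MeasureTheory.Measure (PhaseSpace N'),
          (pinnedChain ω₂ lam β γ).IsSteadyState N' T_L T_R μ →
          (pinnedChain ω₂ lam β γ).IsSteadyState N' T_L T_R ν → μ = ν) →
      ∀ μ : (N' : ℕ) → ℝ → ℝ → MeasureTheory.Measure (PhaseSpace N'),
        (∀ (N' : ℕ) (T_L T_R : ℝ), 0 < T_L → 0 < T_R →
          (pinnedChain ω₂ lam β γ).IsSteadyState N' T_L T_R (μ N' T_L T_R)) →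
        Filter.Tendsto (fun δ : ℝ =>
          (pinnedChain ω₂ lam β γ).totalCurrent (μ N (T + δ / 2) (T - δ / 2)) / δ) (nhdsWithin 0 {(0 : ℝ)}ᶜ)
          (nhds (((N : ℝ) - 1) * γ * ∫ t in Set.Ioi (0 : ℝ), Φ N t * (2 * t / (γ ^ 2 + t ^ 2) ^ 2)))

/-- **Sequence lemma.** A real sequence bounded in absolute value whose `EReal` image converges, converges in
`ℝ`. [folklore] -/
theorem exists_tendsto_of_ereal_tendsto_of_abs_le (D : ℕ → ℝ) {ℓ : EReal}
    (hℓ : Tendsto (fun N : ℕ => ((D N : ℝ) : EReal)) atTop (𝓝 ℓ))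
    {B : ℝ} (hB : ∀ N, |D N| ≤ B) : ∃ L : ℝ, Tendsto D atTop (𝓝 L) := by
  have hℓ_le : ℓ ≤ ((B : ℝ) : EReal) :=
    le_of_tendsto' hℓ fun N => EReal.coe_le_coe_iff.2 ((le_abs_self _).trans (hB N))
  have hℓ_ge : ((-B : ℝ) : EReal) ≤ ℓ :=
    ge_of_tendsto' hℓ fun N => EReal.coe_le_coe_iff.2 (abs_le.1 (hB N)).1
  have hℓ_top : ℓ ≠ ⊤ := ne_top_of_le_ne_top (EReal.coe_ne_top _) hℓ_le
  have hℓ_bot : ℓ ≠ ⊥ := ne_bot_of_le_ne_bot (EReal.coe_ne_bot _) hℓ_ge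
  refine ⟨ℓ.toReal, ?_⟩
  have h : Tendsto (fun N : ℕ => ((D N : ℝ) : EReal)) atTop (𝓝 ((ℓ.toReal : ℝ) : EReal)) := by
    rwa [EReal.coe_toReal hℓ_top hℓ_bot]
  exact EReal.tendsto_coe.1 h

/-- **The physical step, from the two items.** Given `EscapeNonOscillation` (12238) and `BoundedResponse` (10924):
for `pinnedChain ω₂ lam β ·` (all `> 0`), `T > 0`, every representing family `Φ` and every friction `γ > 0`, the
scaled contact transforms `N·∫_(t>0) Φ_N(t)·2t/(γ²+t²)² dt` converge. Along the canonical steady-state family the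
response coefficient `D_N = (N−1)γ∫Φ_N k_γ` (`N ≥ 2`) equals `e_N = (N−1)γE_N` (`responseCoeff_eq_escapeDeficit`),
is bounded (10924) and has an `EReal` limit (12238), hence a real one; `N∫Φ_N k_γ = D_N · N/((N−1)γ)`.
[cite: KunduDharNarayan2009, arXiv:0809.4543 p. 3] -/
theorem scaledTransforms_tendsto_of_items
    (hE : BoundaryEscapeDeficit.EscapeNonOscillation) (hB : OddSectorIrreversibility.BoundedResponse)
    {ω₂ lam β : ℝ} (hω : 0 < ω₂) (hl : 0 < lam) (hβ : 0 < β) {T : ℝ} (hT : 0 < T)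
    (Φ : ℕ → ℝ → ℝ) (hΦ : IsRepresenting ω₂ lam β T Φ) :
    ∀ γ : ℝ, 0 < γ → ∃ L : ℝ,
      Tendsto (fun N : ℕ => (N : ℝ) * ∫ t in Set.Ioi (0 : ℝ), Φ N t * (2 * t / (γ ^ 2 + t ^ 2) ^ 2))
        atTop (𝓝 L) := by
  intro γ hγ
  have hU : ∀ (N : ℕ) (T_L T_R : ℝ), 0 < T_L → 0 < T_R → ∀ μ ν : Measure (PhaseSpace N),
      (pinnedChain ω₂ lam β γ).IsSteadyState N T_L T_R μ →
        (pinnedChain ω₂ lam β γ).IsSteadyState N T_L T_R ν → μ = ν :=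
    Summit.AtomisticToContinuum.FouriersLaw.Theorems.nessUnique_proof ω₂ lam β γ hω hl hβ hγ
  classical
  -- the canonical steady-state family (existence is the landed CEHR theorem; any family would do by uniqueness)
  set μc : (N : ℕ) → ℝ → ℝ → Measure (PhaseSpace N) := fun N T_L T_R =>
    if h : 0 < T_L ∧ 0 < T_R then
      Classical.choose (pinnedChain_exists_isSteadyState hω hl hβ hγ N h.1 h.2) else 0 with hμc
  have hμc' : ∀ (N : ℕ) (T_L T_R : ℝ), 0 < T_L → 0 < T_R →
      (pinnedChain ω₂ lam β γ).IsSteadyState N T_L T_R (μc N T_L T_R) := by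
    intro N T_L T_R hL hR
    have h : 0 < T_L ∧ 0 < T_R := ⟨hL, hR⟩
    simp only [hμc, dif_pos h]
    exact Classical.choose_spec (pinnedChain_exists_isSteadyState hω hl hβ hγ N h.1 h.2)
  -- the response sequence along `μc`: `(N-1)γ∫Φ_N k_γ` for `N ≥ 2`, `0` for the bondless chains `N ≤ 1`
  set I : ℕ → ℝ := fun N => ∫ t in Set.Ioi (0 : ℝ), Φ N t * (2 * t / (γ ^ 2 + t ^ 2) ^ 2) with hI
  set D : ℕ → ℝ := fun N => if 2 ≤ N then ((N : ℝ) - 1) * γ * I N else 0 with hDdef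
  have hD2 : ∀ N : ℕ, 2 ≤ N → D N = ((N : ℝ) - 1) * γ * I N := fun N hN => by
    simp only [hDdef, if_pos hN]
  have hresp : ∀ N : ℕ, Tendsto (fun δ : ℝ =>
      (pinnedChain ω₂ lam β γ).totalCurrent (μc N (T + δ / 2) (T - δ / 2)) / δ) (𝓝[≠] 0) (𝓝 (D N)) := by
    intro N
    by_cases hN : 2 ≤ N
    · rw [hD2 N hN]
      exact (hΦ N hN).2.2.2 γ hγ hU μc hμc'
    · have hD0 : D N = 0 := by simp only [hDdef, if_neg hN]
      rw [hD0]
      have hj : ∀ (i : Fin N) (x : PhaseSpace N), (pinnedChain ω₂ lam β γ).bondCurrent N i x = 0 :=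
        fun i x => by
          unfold OscillatorChain.bondCurrent
          refine Finset.sum_eq_zero fun j _ => ?_
          have hji : ¬ (j.val = i.val + 1) := by have := j.isLt; omega
          rw [if_neg hji]
      have e : (fun δ : ℝ =>
          (pinnedChain ω₂ lam β γ).totalCurrent (μc N (T + δ / 2) (T - δ / 2)) / δ) = fun _ => 0 := by
        funext δ
        have : (pinnedChain ω₂ lam β γ).totalCurrent (μc N (T + δ / 2) (T - δ / 2)) = 0 := by
          unfold OscillatorChain.totalCurrent
          exact Finset.sum_eq_zero fun i _ => by simp only [hj, MeasureTheory.integral_zero]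
        rw [this, zero_div]
      rw [e]
      exact tendsto_const_nhds
  -- item 10924: `|D_N|` bounded
  obtain ⟨Bd, hBd⟩ := hB ω₂ lam β γ hω hl hβ hγ hU μc hμc' T hT D hresp
  have hBd' : ∀ N : ℕ, |D N| ≤ Bd := fun N => hBd ⟨N, rfl⟩
  -- item 12238: `e_N` has an `EReal` limit; by the response identity `D_N = e_N` for `N ≥ 2`
  have hE' := hE ω₂ lam β γ hω hl hβ hγ T hT
  dsimp only at hE'
  obtain ⟨ℓ, hℓ⟩ := hE'
  have hDe : ∀ N : ℕ, 2 ≤ N → D N = ((N : ℝ) - 1) * γ * (1 - γ / T ^ 2 * ∫ u in Set.Ioi (0 : ℝ),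
      if h : 0 < N then ∫ z, ((z.2 ⟨0, h⟩) ^ 2 - T) * (∫ y, ((y.2 ⟨0, h⟩) ^ 2 - T)
        ∂((pinnedChain ω₂ lam β γ).transitionKernel N T T u.toNNReal z))
        ∂((pinnedChain ω₂ lam β γ).gibbsMeasure N T) else 0) := by
    intro N hN
    have hN0 : 0 < N := lt_of_lt_of_le Nat.two_pos hN
    rw [Summit.AtomisticToContinuum.FouriersLaw.Theorems.responseCoeff_eq_escapeDeficit
      hω hl hβ hγ hU μc hμc' hT hN0 (hresp N)]
    simp only [dif_pos hN0]
  have hℓD : Tendsto (fun N : ℕ => ((D N : ℝ) : EReal)) atTop (𝓝 ℓ) := by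
    refine hℓ.congr' ?_
    filter_upwards [eventually_ge_atTop 2] with N hN
    rw [hDe N hN]
  obtain ⟨Lr, hLr⟩ := exists_tendsto_of_ereal_tendsto_of_abs_le D hℓD hBd'
  -- `N·∫Φ_N k_γ = D_N · (N / ((N-1)·γ))` for `N ≥ 2`, and `N/(N-1) → 1`
  refine ⟨Lr * (1 * γ⁻¹), ?_⟩
  have hfrac : Tendsto (fun N : ℕ => (N : ℝ) / ((N : ℝ) + (-1 : ℝ))) atTop (𝓝 1) :=
    tendsto_natCast_div_add_atTop (-1 : ℝ)
  have h2 : Tendsto (fun N : ℕ => D N * ((N : ℝ) / ((N : ℝ) + (-1 : ℝ)) * γ⁻¹)) atTop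
      (𝓝 (Lr * (1 * γ⁻¹))) :=
    hLr.mul (hfrac.mul tendsto_const_nhds)
  refine h2.congr' ?_
  filter_upwards [eventually_ge_atTop 2] with N hN
  rw [hD2 N hN]
  have hN1 : (N : ℝ) + (-1 : ℝ) ≠ 0 := by
    have : (2 : ℝ) ≤ (N : ℝ) := by exact_mod_cast hN
    linarith
  have hγ0 : γ ≠ 0 := hγ.ne'
  have alg : ∀ J : ℝ,
      ((N : ℝ) - 1) * γ * J * ((N : ℝ) / ((N : ℝ) + (-1 : ℝ)) * γ⁻¹) = (N : ℝ) * J := by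
    intro J
    field_simp
    ring
  exact alg _

/-! ## Glue, part 2: the continuity theorem transports transform convergence to `N·Φ_N` (as in `birth`) -/

/-- Bookkeeping: the rescaled family `N·Φ_N`, truncated to `0` below `N = 2` (where the crux's hypothesis says
nothing about `Φ_N`). -/
def scaledFamily (Φ : ℕ → ℝ → ℝ) (N : ℕ) (t : ℝ) : ℝ :=
  if 2 ≤ N then (N : ℝ) * Φ N t else 0

theorem scaledFamily_of_le {Φ : ℕ → ℝ → ℝ} {N : ℕ} (hN : 2 ≤ N) (t : ℝ) :
    scaledFamily Φ N t = (N : ℝ) * Φ N t := if_pos hN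

theorem scaledFamily_of_not_le {Φ : ℕ → ℝ → ℝ} {N : ℕ} (hN : ¬ 2 ≤ N) (t : ℝ) :
    scaledFamily Φ N t = 0 := if_neg hN

/-- GLUE (sorry-free): the continuity theorem (hypothesis `hS` = the statement of `stub_stieltjesContinuity`)
turns per-friction convergence of the scaled transforms `N·∫ Φ_N k_γ` of a family that is monotone / vanishing on
`(-∞,0]` / bounded from `N = 2` on into convergence of `N·Φ_N(t)` at the continuity points of a monotone `M`. -/
theorem tendsto_scaled_of_transforms
    (hS : ∀ F : ℕ → ℝ → ℝ,
      (∀ N : ℕ, Monotone (F N) ∧ (∀ s : ℝ, s ≤ 0 → F N s = 0) ∧ (∃ m : ℝ, ∀ s : ℝ, F N s ≤ m)) →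
      (∀ γ : ℝ, 0 < γ → ∃ L : ℝ,
        Filter.Tendsto (fun N : ℕ => ∫ t in Set.Ioi (0 : ℝ), F N t * (2 * t / (γ ^ 2 + t ^ 2) ^ 2))
          Filter.atTop (nhds L)) →
      ∃ M : ℝ → ℝ, Monotone M ∧ ∀ t : ℝ, 0 < t → ContinuousAt M t →
        Filter.Tendsto (fun N : ℕ => F N t) Filter.atTop (nhds (M t)))
    (Φ : ℕ → ℝ → ℝ)
    (hΦ : ∀ N : ℕ, 2 ≤ N → Monotone (Φ N) ∧ (∀ s : ℝ, s ≤ 0 → Φ N s = 0) ∧ (∃ m : ℝ, ∀ s : ℝ, Φ N s ≤ m))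
    (hC : ∀ γ : ℝ, 0 < γ → ∃ L : ℝ,
      Filter.Tendsto (fun N : ℕ => (N : ℝ) * ∫ t in Set.Ioi (0 : ℝ), Φ N t * (2 * t / (γ ^ 2 + t ^ 2) ^ 2))
        Filter.atTop (nhds L)) :
    ∃ M : ℝ → ℝ, Monotone M ∧ ∀ t : ℝ, 0 < t → ContinuousAt M t →
      Filter.Tendsto (fun N : ℕ => (N : ℝ) * Φ N t) Filter.atTop (nhds (M t)) := by
  have h1 : ∀ N : ℕ, Monotone (scaledFamily Φ N) ∧ (∀ s : ℝ, s ≤ 0 → scaledFamily Φ N s = 0) ∧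
      (∃ m : ℝ, ∀ s : ℝ, scaledFamily Φ N s ≤ m) := by
    intro N
    by_cases hN : 2 ≤ N
    · obtain ⟨hmono, hzero, ⟨m, hm⟩⟩ := hΦ N hN
      have hN0 : (0 : ℝ) ≤ (N : ℝ) := Nat.cast_nonneg N
      refine ⟨fun a b hab => ?_, fun s hs => ?_, ⟨(N : ℝ) * m, fun s => ?_⟩⟩
      · rw [scaledFamily_of_le hN, scaledFamily_of_le hN]
        exact mul_le_mul_of_nonneg_left (hmono hab) hN0
      · rw [scaledFamily_of_le hN, hzero s hs, mul_zero]
      · rw [scaledFamily_of_le hN]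
        exact mul_le_mul_of_nonneg_left (hm s) hN0
    · refine ⟨fun a b _ => ?_, fun s _ => scaledFamily_of_not_le hN s, ⟨0, fun s => ?_⟩⟩
      · rw [scaledFamily_of_not_le hN, scaledFamily_of_not_le hN]
      · rw [scaledFamily_of_not_le hN]
  have h2 : ∀ γ : ℝ, 0 < γ → ∃ L : ℝ, Filter.Tendsto
      (fun N : ℕ => ∫ t in Set.Ioi (0 : ℝ), scaledFamily Φ N t * (2 * t / (γ ^ 2 + t ^ 2) ^ 2))
      Filter.atTop (nhds L) := by
    intro γ hγ
    obtain ⟨L, hL⟩ := hC γ hγ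
    refine ⟨L, hL.congr' ?_⟩
    filter_upwards [Filter.eventually_ge_atTop 2] with N hN
    have hfun : (fun t : ℝ => scaledFamily Φ N t * (2 * t / (γ ^ 2 + t ^ 2) ^ 2)) =
        fun t : ℝ => (N : ℝ) * (Φ N t * (2 * t / (γ ^ 2 + t ^ 2) ^ 2)) := by
      funext t
      rw [scaledFamily_of_le hN, mul_assoc]
    rw [hfun, MeasureTheory.integral_const_mul]
  obtain ⟨M, hMmono, hM⟩ := hS (scaledFamily Φ) h1 h2
  refine ⟨M, hMmono, fun t ht hct => ?_⟩
  refine (hM t ht hct).congr' ?_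
  filter_upwards [Filter.eventually_ge_atTop 2] with N hN
  exact scaledFamily_of_le hN t

/-! ## The composition -/

/-- **(M) from its three pieces, hypotheses explicit** (this is also the glue of the staged route-level split
`ContactMeasureLimit ⇐ StieltjesContinuity ∧ EscapeNonOscillation ∧ BoundedResponse`): sorry-free. -/
theorem contactMeasureLimit_of_hyps
    (hS : ∀ F : ℕ → ℝ → ℝ,
      (∀ N : ℕ, Monotone (F N) ∧ (∀ s : ℝ, s ≤ 0 → F N s = 0) ∧ (∃ m : ℝ, ∀ s : ℝ, F N s ≤ m)) →
      (∀ γ : ℝ, 0 < γ → ∃ L : ℝ,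
        Filter.Tendsto (fun N : ℕ => ∫ t in Set.Ioi (0 : ℝ), F N t * (2 * t / (γ ^ 2 + t ^ 2) ^ 2))
          Filter.atTop (nhds L)) →
      ∃ M : ℝ → ℝ, Monotone M ∧ ∀ t : ℝ, 0 < t → ContinuousAt M t →
        Filter.Tendsto (fun N : ℕ => F N t) Filter.atTop (nhds (M t)))
    (hE : BoundaryEscapeDeficit.EscapeNonOscillation) (hB : OddSectorIrreversibility.BoundedResponse) :
    ContactStieltjesMeasure.ContactMeasureLimit := by
  intro ω₂ lam β hω hl hβ T hT Φ hΦ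
  exact tendsto_scaled_of_transforms hS Φ (fun N hN => ⟨(hΦ N hN).1, (hΦ N hN).2.1, (hΦ N hN).2.2.1⟩)
    (scaledTransforms_tendsto_of_items hE hB hω hl hβ hT Φ hΦ)

/-- ASSEMBLY (A12 skeleton shape): the crux `ContactMeasureLimit`, concluded BY NAME from the three stubs BY
NAME; `sorry` occurs only inside `stub_*`. -/
theorem ContactMeasureLimit_of :
    Summit.AtomisticToContinuum.FouriersLaw.Theses.ContactStieltjesMeasure.ContactMeasureLimit :=
  contactMeasureLimit_of_hyps stub_stieltjesContinuity stub_escapeNonOscillation stub_boundedResponse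

end Summit.AtomisticToContinuum.FouriersLaw.Cruxes.ContactMeasureLimit.EscapeImport

end
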